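import Mathlib
import HarnessLib
import Summits.HubbardSuperconductivity.HubbardSuperconductivity.Theorems.WeakCouplingBCSDefsKlThirdOrder
import Summits.HubbardSuperconductivity.HubbardSuperconductivity.Theorems.WeakCouplingBCSKlThirdOrderFrequencyIntegrals

/-!
# Route `WeakCouplingBCS` — channel-margin lane of `WcbcsKohnLuttingerB1g` (stmt-HubbardSuperconductivity-0158):
# the closed-form case tables `jV`, `jOcc`, `jEmp` ARE the `T = 0` frequency integrals of the two-loop diagrams

`Theorems/WeakCouplingBCSDefsKlThirdOrder.lean` defines the two genuinely two-loop third-order kernels `T_V`, `T_P`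
of the particle–particle-irreducible Cooper vertex directly in their `T = 0` reduced form: the frequency integral of
the two outer free propagators `G(p₀, ξ) = (ip₀ - ξ)⁻¹` against one atom of a pair measure is entered as a
closed-form CASE TABLE in the signs of the outer energies `a, b` —
`jV D a b` (particle–hole pair of energy `D`, pair line `2D/(D² + p₀²)`, diagrams (3e)–(3f)),
`jOcc E a b` (occupied particle–particle pair, pair line `(E + ip₀)⁻¹`) and `jEmp E a b` (empty pair,
`(E - ip₀)⁻¹`; diagrams (3b)–(3c)).  That these tables are the frequency integrals was so far a paper step of the
cell's `T = 0` reduction (U0-TABLE.md v1 §1′), checked numerically at 13 sample points (`margin-1-g7/code/check_freq.py`,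
`check_freq_pp.py`) and for one sign case by hand (REF-CHECK §187 (R-def)).  This file PROVES them for all
`D, E > 0` and all `a, b ≠ 0`:

* `jOcc_eq_frequencyIntegral`: `∫_ℝ dp₀ G(p₀,a) G(p₀,b) (E + ip₀)⁻¹ = 2π · jOcc E a b`;
* `jEmp_eq_frequencyIntegral`: `∫_ℝ dp₀ G(p₀,a) G(p₀,b) (E - ip₀)⁻¹ = 2π · jEmp E a b`;
* `jV_eq_frequencyIntegral`:   `∫_ℝ dp₀ G(p₀,a) G(p₀,b) · 2D/(D² + p₀²) = 2π · jV D a b`,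
  via `2D/(D² + p₀²) = (ip₀ + D)⁻¹ - (ip₀ - D)⁻¹` and the elementary `jV = jOcc + jEmp` (`jV_eq_jOcc_add_jEmp`);

from the residue lemmas of `Theorems/WeakCouplingBCSKlThirdOrderFrequencyIntegrals.lean` (every sign pattern of three
nonzero energies; the case tables' branches are exactly the pole configurations: same side of the Fermi curve ↔ the
positive Loewner products, opposite sides ↔ the negative divided differences, `0` ↔ all poles in one half-plane).

What this removes from the trusted base of the explicit-`U₀` rows: the frequency integration of the two-loop diagrams.
What remains paper-level (U0-TABLE.md v3.1 §3 (i)): the diagram ↔ integrand bookkeeping (prefactors `-(-U)ⁿ(-1)^{loops}`,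
the factor `2`, momentum routing) and the integrability of the momentum integrals; nothing here asserts a pairing
instability.

References: S. Raghu, S. A. Kivelson, D. J. Scalapino, Phys. Rev. B 81 (2010) 224505, App. A (diagrams (3a)–(3f)).
-/

noncomputable section

-- the tree's namespace `Summit.<Summit>.<Problem>.Theorems` repeats the summit name by design (D-0017)
set_option linter.dupNamespace false

namespace Summit.HubbardSuperconductivity.HubbardSuperconductivity.Theorems

open MeasureTheory Complex Real KlThirdOrder FreqIntegral

namespace KlThirdOrder

/-! ### The crossed particle–particle insertion `T_P`: occupied and empty pair atoms -/

/-- **Occupied-pair atom, core form.** For a pair energy `E > 0` below the Fermi level and outer energies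
`a, b ≠ 0`: `∫_ℝ dp₀ (ip₀ - a)⁻¹ (ip₀ - b)⁻¹ (ip₀ + E)⁻¹ = 2π · jOcc E a b` — the frequency integral of the two outer
propagators of diagram (3b) against one atom `(ip₀ - (-E))⁻¹` of the occupied-pair measure IS the closed-form case
table `jOcc` of `WeakCouplingBCSDefsKlThirdOrder.lean` (all four sign cases of `(a, b)`).
[cite: RaghuKivelsonScalapino2010, App. A (3b)] -/
theorem integral_propagators_occAtom {E a b : ℝ} (hE : 0 < E) (ha : a ≠ 0) (hb : b ≠ 0) :
    ∫ p : ℝ, 1 / (I * (p : ℂ) - a) * (1 / (I * (p : ℂ) - b)) * (1 / (I * (p : ℂ) - ((-E : ℝ) : ℂ))) =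
      ((2 * π * jOcc E a b : ℝ) : ℂ) := by
  have hE' : -E < 0 := by linarith
  rcases lt_or_gt_of_ne ha with ha' | ha'
  · rcases lt_or_gt_of_ne hb with hb' | hb'
    · -- `a, b < 0`: three occupied states
      rw [integral_propagator_triple_eq_zero_of_neg ha' hb' hE']
      have hr : jOcc E a b = 0 := by
        unfold jOcc
        rw [if_neg (fun h => by linarith [h.1]),
          if_neg (not_lt.2 (le_of_lt (mul_pos_of_neg_of_neg ha' hb')))]
      rw [hr]; simp
    · -- `a < 0 < b`
      have hcomm : ∀ p : ℝ, 1 / (I * (p : ℂ) - a) * (1 / (I * (p : ℂ) - b)) * (1 / (I * (p : ℂ) - ((-E : ℝ) : ℂ))) =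
          1 / (I * (p : ℂ) - a) * (1 / (I * (p : ℂ) - ((-E : ℝ) : ℂ))) * (1 / (I * (p : ℂ) - b)) :=
        fun p => by ring
      simp_rw [hcomm]
      rw [integral_propagator_triple_of_neg_neg_pos ha' hE' hb']
      have hr : -(2 * π) / ((b - a) * (b - -E)) = 2 * π * jOcc E a b := by
        unfold jOcc
        rw [if_neg (fun h => by linarith [h.1]), if_pos (mul_neg_of_neg_of_pos ha' hb'),
          max_eq_right (le_of_lt (ha'.trans hb')), abs_of_neg ha', abs_of_pos hb']
        have h1 : b - a ≠ 0 := by linarith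
        have h2 : b - -E ≠ 0 := by linarith
        have h3 : E + b ≠ 0 := by linarith
        have h4 : -a + b ≠ 0 := by linarith
        field_simp
        ring
      rw [hr]
  · rcases lt_or_gt_of_ne hb with hb' | hb'
    · -- `b < 0 < a`
      have hcomm : ∀ p : ℝ, 1 / (I * (p : ℂ) - a) * (1 / (I * (p : ℂ) - b)) * (1 / (I * (p : ℂ) - ((-E : ℝ) : ℂ))) =
          1 / (I * (p : ℂ) - b) * (1 / (I * (p : ℂ) - ((-E : ℝ) : ℂ))) * (1 / (I * (p : ℂ) - a)) :=
        fun p => by ring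
      simp_rw [hcomm]
      rw [integral_propagator_triple_of_neg_neg_pos hb' hE' ha']
      have hr : -(2 * π) / ((a - b) * (a - -E)) = 2 * π * jOcc E a b := by
        unfold jOcc
        rw [if_neg (fun h => by linarith [h.2]), if_pos (mul_neg_of_pos_of_neg ha' hb'),
          max_eq_left (le_of_lt (hb'.trans ha')), abs_of_pos ha', abs_of_neg hb']
        have h1 : a - b ≠ 0 := by linarith
        have h2 : a - -E ≠ 0 := by linarith
        have h3 : E + a ≠ 0 := by linarith
        have h4 : a + -b ≠ 0 := by linarith
        field_simp
        ring
      rw [hr]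
    · -- `a, b > 0`: the two outer states empty, the pair occupied
      rw [integral_propagator_triple_of_pos_pos_neg ha' hb' hE']
      have hr : 2 * π / ((-E - a) * (-E - b)) = 2 * π * jOcc E a b := by
        unfold jOcc
        rw [if_pos ⟨ha', hb'⟩]
        have h1 : -E - a ≠ 0 := by linarith
        have h2 : -E - b ≠ 0 := by linarith
        have h3 : E + a ≠ 0 := by linarith
        have h4 : E + b ≠ 0 := by linarith
        field_simp
        ring
      rw [hr]

/-- **Empty-pair atom, core form.** For a pair energy `E > 0` above the Fermi level and `a, b ≠ 0`:
`∫_ℝ dp₀ (ip₀ - a)⁻¹ (ip₀ - b)⁻¹ (ip₀ - E)⁻¹ = -2π · jEmp E a b` (the empty-pair atom enters diagram (3b) as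
`(E - ip₀)⁻¹ = -(ip₀ - E)⁻¹`, whence the sign; all four sign cases of `(a, b)`).
[cite: RaghuKivelsonScalapino2010, App. A (3b)] -/
theorem integral_propagators_empAtom {E a b : ℝ} (hE : 0 < E) (ha : a ≠ 0) (hb : b ≠ 0) :
    ∫ p : ℝ, 1 / (I * (p : ℂ) - a) * (1 / (I * (p : ℂ) - b)) * (1 / (I * (p : ℂ) - E)) =
      ((-(2 * π * jEmp E a b) : ℝ) : ℂ) := by
  rcases lt_or_gt_of_ne ha with ha' | ha'
  · rcases lt_or_gt_of_ne hb with hb' | hb'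
    · -- `a, b < 0`
      rw [integral_propagator_triple_of_neg_neg_pos ha' hb' hE]
      have hr : -(2 * π) / ((E - a) * (E - b)) = -(2 * π * jEmp E a b) := by
        unfold jEmp
        rw [if_pos ⟨ha', hb'⟩, abs_of_neg ha', abs_of_neg hb']
        have h1 : E - a ≠ 0 := by linarith
        have h2 : E - b ≠ 0 := by linarith
        have h3 : E + -a ≠ 0 := by linarith
        have h4 : E + -b ≠ 0 := by linarith
        field_simp
        ring
      rw [hr]
    · -- `a < 0 < b`
      have hcomm : ∀ p : ℝ, 1 / (I * (p : ℂ) - a) * (1 / (I * (p : ℂ) - b)) * (1 / (I * (p : ℂ) - E)) =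
          1 / (I * (p : ℂ) - b) * (1 / (I * (p : ℂ) - E)) * (1 / (I * (p : ℂ) - a)) :=
        fun p => by ring
      simp_rw [hcomm]
      rw [integral_propagator_triple_of_pos_pos_neg hb' hE ha']
      have hr : 2 * π / ((a - b) * (a - E)) = -(2 * π * jEmp E a b) := by
        unfold jEmp
        rw [if_neg (fun h => by linarith [h.2]), if_pos (mul_neg_of_neg_of_pos ha' hb'),
          min_eq_left (le_of_lt (ha'.trans hb')), abs_of_neg ha', abs_of_pos hb']
        have h1 : a - b ≠ 0 := by linarith
        have h2 : a - E ≠ 0 := by linarith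
        have h3 : E - a ≠ 0 := by linarith
        have h4 : -a + b ≠ 0 := by linarith
        field_simp
        ring
      rw [hr]
  · rcases lt_or_gt_of_ne hb with hb' | hb'
    · -- `b < 0 < a`
      have hcomm : ∀ p : ℝ, 1 / (I * (p : ℂ) - a) * (1 / (I * (p : ℂ) - b)) * (1 / (I * (p : ℂ) - E)) =
          1 / (I * (p : ℂ) - a) * (1 / (I * (p : ℂ) - E)) * (1 / (I * (p : ℂ) - b)) :=
        fun p => by ring
      simp_rw [hcomm]
      rw [integral_propagator_triple_of_pos_pos_neg ha' hE hb']
      have hr : 2 * π / ((b - a) * (b - E)) = -(2 * π * jEmp E a b) := by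
        unfold jEmp
        rw [if_neg (fun h => by linarith [h.1]), if_pos (mul_neg_of_pos_of_neg ha' hb'),
          min_eq_right (le_of_lt (hb'.trans ha')), abs_of_pos ha', abs_of_neg hb']
        have h1 : b - a ≠ 0 := by linarith
        have h2 : b - E ≠ 0 := by linarith
        have h3 : E - b ≠ 0 := by linarith
        have h4 : a + -b ≠ 0 := by linarith
        field_simp
        ring
      rw [hr]
    · -- `a, b > 0`: three empty states
      rw [integral_propagator_triple_eq_zero_of_pos ha' hb' hE]
      have hr : jEmp E a b = 0 := by
        unfold jEmp
        rw [if_neg (fun h => by linarith [h.1]), if_neg (not_lt.2 (le_of_lt (mul_pos ha' hb')))]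
      rw [hr]; simp

/-- **The occupied-pair frequency integral of diagram (3b).** With the free propagator `G(p₀, ξ) = (ip₀ - ξ)⁻¹` and an
occupied pair of energy `E > 0` (pair line `(E + ip₀)⁻¹`), for outer energies `a, b ≠ 0`:
`∫_ℝ dp₀ G(p₀,a) G(p₀,b) (E + ip₀)⁻¹ = 2π · jOcc E a b`.  This is the identity the definition `psiP` presupposes
(cell file U0-TABLE.md v1 §1′ (ii); previously checked numerically, `margin-1-g7/code/check_freq_pp.py`).
[cite: RaghuKivelsonScalapino2010, App. A (3b)] -/
theorem jOcc_eq_frequencyIntegral {E a b : ℝ} (hE : 0 < E) (ha : a ≠ 0) (hb : b ≠ 0) :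
    ∫ p : ℝ, 1 / (I * (p : ℂ) - a) * (1 / (I * (p : ℂ) - b)) * (1 / ((E : ℂ) + I * p)) =
      ((2 * π * jOcc E a b : ℝ) : ℂ) := by
  have hpt : ∀ p : ℝ, (1 : ℂ) / ((E : ℂ) + I * p) = 1 / (I * (p : ℂ) - ((-E : ℝ) : ℂ)) := by
    intro p; push_cast; ring
  simp_rw [hpt]
  exact integral_propagators_occAtom hE ha hb

/-- **The empty-pair frequency integral of diagram (3b).** With an empty pair of energy `E > 0` (pair line
`(E - ip₀)⁻¹`), for `a, b ≠ 0`: `∫_ℝ dp₀ G(p₀,a) G(p₀,b) (E - ip₀)⁻¹ = 2π · jEmp E a b` (U0-TABLE.md v1 §1′ (ii)).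
[cite: RaghuKivelsonScalapino2010, App. A (3b)] -/
theorem jEmp_eq_frequencyIntegral {E a b : ℝ} (hE : 0 < E) (ha : a ≠ 0) (hb : b ≠ 0) :
    ∫ p : ℝ, 1 / (I * (p : ℂ) - a) * (1 / (I * (p : ℂ) - b)) * (1 / ((E : ℂ) - I * p)) =
      ((2 * π * jEmp E a b : ℝ) : ℂ) := by
  have hpt : ∀ p : ℝ, 1 / (I * (p : ℂ) - a) * (1 / (I * (p : ℂ) - b)) * (1 / ((E : ℂ) - I * p)) =
      -(1 / (I * (p : ℂ) - a) * (1 / (I * (p : ℂ) - b)) * (1 / (I * (p : ℂ) - E))) := by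
    intro p
    rw [← neg_sub (I * (p : ℂ)) (E : ℂ), one_div_neg_eq_neg_one_div]
    ring
  simp_rw [hpt]
  rw [integral_neg, integral_propagators_empAtom hE ha hb]
  push_cast
  ring

/-! ### The bubble-exchange vertex correction `T_V`: a particle–hole pair atom -/

/-- The particle–hole pair line splits into an occupied-type and an empty-type atom:
`jV D a b = jOcc D a b + jEmp D a b` for `D > 0`, `a, b ≠ 0` (elementary; mirrors
`2D/(D² + p₀²) = (D + ip₀)⁻¹ + (D - ip₀)⁻¹`). [folklore] -/
theorem jV_eq_jOcc_add_jEmp {D a b : ℝ} (hD : 0 < D) (ha : a ≠ 0) (hb : b ≠ 0) :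
    jV D a b = jOcc D a b + jEmp D a b := by
  unfold jV jOcc jEmp
  rcases lt_or_gt_of_ne ha with ha' | ha'
  · rcases lt_or_gt_of_ne hb with hb' | hb'
    · rw [if_pos (mul_pos_of_neg_of_neg ha' hb'), if_neg (fun h => by linarith [h.1]),
        if_neg (not_lt.2 (le_of_lt (mul_pos_of_neg_of_neg ha' hb'))), if_pos ⟨ha', hb'⟩]
      ring
    · rw [if_neg (not_lt.2 (le_of_lt (mul_neg_of_neg_of_pos ha' hb'))), if_neg (fun h => by linarith [h.1]),
        if_pos (mul_neg_of_neg_of_pos ha' hb'), if_neg (fun h => by linarith [h.2]),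
        if_pos (mul_neg_of_neg_of_pos ha' hb'), max_eq_right (le_of_lt (ha'.trans hb')),
        min_eq_left (le_of_lt (ha'.trans hb')), abs_of_neg ha', abs_of_pos hb']
      have h1 : D + -a ≠ 0 := by linarith
      have h2 : D + b ≠ 0 := by linarith
      have h3 : -a + b ≠ 0 := by linarith
      have h4 : D - a ≠ 0 := by linarith
      field_simp
      ring
  · rcases lt_or_gt_of_ne hb with hb' | hb'
    · rw [if_neg (not_lt.2 (le_of_lt (mul_neg_of_pos_of_neg ha' hb'))), if_neg (fun h => by linarith [h.2]),
        if_pos (mul_neg_of_pos_of_neg ha' hb'), if_neg (fun h => by linarith [h.1]),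
        if_pos (mul_neg_of_pos_of_neg ha' hb'), max_eq_left (le_of_lt (hb'.trans ha')),
        min_eq_right (le_of_lt (hb'.trans ha')), abs_of_pos ha', abs_of_neg hb']
      have h1 : D + a ≠ 0 := by linarith
      have h2 : D + -b ≠ 0 := by linarith
      have h3 : a + -b ≠ 0 := by linarith
      have h4 : D - b ≠ 0 := by linarith
      field_simp
      ring
    · rw [if_pos (mul_pos ha' hb'), if_pos ⟨ha', hb'⟩, if_neg (fun h => by linarith [h.1]),
        if_neg (not_lt.2 (le_of_lt (mul_pos ha' hb'))), abs_of_pos ha', abs_of_pos hb']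
      ring

/-- **The particle–hole-pair frequency integral of diagrams (3e)–(3f).** With `G(p₀, ξ) = (ip₀ - ξ)⁻¹` and the
pair line `2D/(D² + p₀²)` of a particle–hole pair of energy `D > 0`, for outer energies `a, b ≠ 0`:
`∫_ℝ dp₀ G(p₀,a) G(p₀,b) · 2D/(D² + p₀²) = 2π · jV D a b` — the identity the definition `psiV` presupposes
(U0-TABLE.md v1 §1′ (i); previously checked numerically, `margin-1-g7/code/check_freq.py`, and for one sign case by
residues by hand, REF-CHECK §187).  Same side (`ab > 0`): the positive Loewner product `((D+|a|)(D+|b|))⁻¹`; opposite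
sides: `-((D+|a|)⁻¹ + (D+|b|)⁻¹)/(|a|+|b|)`. [cite: RaghuKivelsonScalapino2010, App. A (3e)] -/
theorem jV_eq_frequencyIntegral {D a b : ℝ} (hD : 0 < D) (ha : a ≠ 0) (hb : b ≠ 0) :
    ∫ p : ℝ, 1 / (I * (p : ℂ) - a) * (1 / (I * (p : ℂ) - b)) * (2 * (D : ℂ) / ((D : ℂ) ^ 2 + (p : ℂ) ^ 2)) =
      ((2 * π * jV D a b : ℝ) : ℂ) := by
  have hD0 : D ≠ 0 := ne_of_gt hD
  have hnegD : -D ≠ 0 := by linarith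
  -- the pair line as a difference of two propagators
  have hpt : ∀ p : ℝ, (2 * (D : ℂ)) / ((D : ℂ) ^ 2 + (p : ℂ) ^ 2) =
      1 / (I * (p : ℂ) - ((-D : ℝ) : ℂ)) - 1 / (I * (p : ℂ) - D) := by
    intro p
    have h1 : I * (p : ℂ) - ((-D : ℝ) : ℂ) ≠ 0 := propagatorDen_ofReal_ne_zero hnegD p
    have h2 : I * (p : ℂ) - (D : ℂ) ≠ 0 := propagatorDen_ofReal_ne_zero hD0 p
    have h3 : (D : ℂ) ^ 2 + (p : ℂ) ^ 2 ≠ 0 := by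
      have : (0 : ℝ) < D ^ 2 + p ^ 2 := by positivity
      exact_mod_cast this.ne'
    rw [div_sub_div _ _ h1 h2, div_eq_div_iff h3 (mul_ne_zero h1 h2)]
    push_cast
    ring_nf
    rw [Complex.I_sq]
    ring
  simp_rw [hpt, mul_sub]
  rw [integral_sub ((integrable_propagator_triple ha hb hnegD)) (integrable_propagator_triple ha hb hD0),
    integral_propagators_occAtom hD ha hb, integral_propagators_empAtom hD ha hb, jV_eq_jOcc_add_jEmp hD ha hb]
  push_cast
  ring

end KlThirdOrder

end Summit.HubbardSuperconductivity.HubbardSuperconductivity.Theorems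

end
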